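import Literature.AlgebraicGeometry.Motives.MotivatedPeriodTorsor
import HarnessLib

/-!
# Filtered points of the torsor of motivated periods and their Zariski density

Companion to `Motives/MotivatedPeriodTorsor.lean` (same namespace
`Literature.AlgebraicGeometry.Motives.PeriodRealization`; kept in its own module because the host
file is at the 400-line cap, CONVENTIONS §9). Definition request
`defn-PeriodRealization.FilteredTorsorPeriodConjecture` of route `HodgeConjecture/PeriodsPolice`
(crux `GrothendieckPeriodConjecture`, support `TorsorGPCImpliesPolicing`, whose δ-unfolded one-liners
these declarations refold 1:1: the inner hypothesis is `f₀.IsFiltered`, the density clause is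
`P.FilteredPointsDense σ n X₀`).

Let `k` be a field of characteristic zero, `P : PeriodRealization k` the de Rham–Betti comparison
data (`Motives/PeriodComparison.lean`), `σ : k →+* ℂ`, `X₀` a smooth projective `k`-variety of
dimension `n`, `Ω^And_{X₀}` its torsor of motivated periods (Bost–Charles 2014, Def. 2.4 and
Def. 2.9; `R`-points `P.MotivatedPeriodTorsor σ n X₀ R`, affine coordinates `Coord`/`coord`) and
`c ∈ Ω^And_{X₀}(ℂ)` the comparison isomorphism (`comparisonPoint`; loc. cit. Cor. 2.11).

* `MotivatedPeriodTorsor.IsFiltered f₀` — a complex point `f₀ ∈ Ω^And_{X₀}(ℂ)` **is filtered**: on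
  every power `X₀^m` and in every degree `i` it carries the Hodge filtration of de Rham cohomology,
  base-changed along `σ`, onto the Hodge filtration of the Hodge structure on Betti cohomology,
  `f₀ (Fᵖ Hⁱ_dR(X₀^m) ⊗_{k,σ} ℂ) = Fᵖ (Hⁱ_B((X₀^m)_σ) ⊗_ℚ ℂ)` for all `p` — literally the shape of
  the axiom `PeriodRealization.iso_fil` (Deligne 1982, Thm. 1.4: the comparison isomorphism is
  filtered), asked of an arbitrary point. The comparison is filtered (`isFiltered_comparisonPoint`).
  In Tannakian terms (Deligne–Milne 1982, end of §5, referring to Saavedra 1972, IV.2, for filtered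
  fibre functors) the filtered complex points form the right translate `c · Q(ℂ)` of the stabiliser
  `Q ⊂ G^dR` of the Hodge filtration of the de Rham fibre functor, a parabolic subgroup; this
  reading is commentary only and is not used.
* `FilteredPointsDense P σ n X₀ : Prop` — **the filtered complex points are `k`-Zariski dense in
  `Ω^And_{X₀}`**, rendered on coordinates exactly like `TorsorPeriodConjecture`: every polynomial over
  `k` in the coordinates vanishing at every filtered complex point vanishes at every `R`-point, for
  every commutative `k`-algebra `R` (informally `Z_{X₀} · Q = Ω^And_{X₀}`). A `Prop`-valued PREDICATE
  of the data `(P, σ, n, X₀)`, binders explicit (like `AndrePeriodBound`,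
  `BettiHodgeData.HodgeConjectureFor`), asserted nowhere in this file: it is IMPLIED by the torsor
  (motivated) form `Z_{X₀} = Ω^And_{X₀}` of the Grothendieck period conjecture
  (`TorsorPeriodConjecture`; Bost–Charles 2014, Conj. 2.12 with Cor. 2.11), because `c` is a filtered
  point: `TorsorPeriodConjecture.filteredPointsDense`. The quantified statement (over the pinned
  classical realization over `ℚ̄`, all `σ` and all smooth projective `X₀`; requested under the name
  `FilteredTorsorPeriodConjecture`, the "filtered (parabolic) form" of the period conjecture) is the
  consuming route's own crux under `Summits/…`, not a Literature fact (gate rule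
  `literature.conjecture`).
* API: `isFiltered_comparisonPoint`, `IsFiltered.mem_hodgeF_iff` (membership form of the filtered
  condition), `TorsorPeriodConjecture.filteredPointsDense`, `FilteredPointsDense.coord_eq_zero` (the
  linear case: a coordinate vanishing at every filtered complex point vanishes at every point — the
  form consumed by `TorsorGPCImpliesPolicing`).

## Design notes

* Nothing here is new mathematics: `IsFiltered` is the conjunction over `(m, i, p)` of the
  `iso_fil` equations, stated verbatim in the form the route items use (restriction of scalars to `ℚ`
  and transport along `alongHomTensorEquiv`, because the Hodge filtration of `B.hodge` lives on
  `ℂ ⊗_ℚ H_B` while `f₀` lands in `AlongHom ℂ σ ⊗_ℚ H_B`); the proof `hXσ` of smoothness of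
  `(X₀^m)_σ` is quantified over, as in `iso_fil` and `IsAbsoluteHodge` (`IsSmoothProjective` is a
  `Prop`, `B.hodge hXσ i` does not depend on the choice).
* Only complex points (`R = AlongHom ℂ σ`) can be filtered: the Hodge filtration on the Betti side
  exists only after `⊗ ℂ`.
* STATUS of `FilteredPointsDense P σ n X₀`: a property of the data with content exactly for `k = ℚ̄`,
  the classical realization and `X₀` smooth projective, where it follows from `GPC_And(X₀)` (open
  beyond a few cases, Bost–Charles 2014, §2.2.2) and is established unconditionally by no one; this
  file asserts it nowhere. For `X₀` not smooth projective or junk data it is meaningless, like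
  `TorsorPeriodConjecture`.

## References

* J.-B. Bost, F. Charles, *Some remarks concerning the Grothendieck period conjecture*, J. reine
  angew. Math. 714 (2016), arXiv:1307.1045: Def. 2.4, Def. 2.9, Cor. 2.11, Conj. 2.12, §2.2.2.
  [BostCharles2014]
* P. Deligne, *Hodge cycles on abelian varieties* (notes by J. Milne), in LNM 900 (1982), §1,
  Thm. 1.4. [Deligne1982HodgeCycles]
* P. Deligne, J. Milne, *Tannakian categories*, in LNM 900 (1982), Prop. 6.1 (e) and end of §5
  ("Filtered Tannakian categories": Saavedra, LNM 265, IV.2). [DeligneMilne1982]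
* A. Huber, S. Müller-Stach, *Periods and Nori motives* III (draft 2015), Def. 12.2.3,
  Conj. 12.2.5. [HuberMullerStachPeriodsIII2015]
-/

open CategoryTheory AlgebraicGeometry MonoidalCategory Opposite
open scoped TensorProduct

noncomputable section

namespace Literature.AlgebraicGeometry.Motives

namespace PeriodRealization

variable {k : Type} [Field k] [CharZero k]

/-! ### Filtered complex points -/

namespace MotivatedPeriodTorsor

variable {P : PeriodRealization k} {σ : k →+* ℂ} {n : ℕ} {X₀ : SchemeOver k}

/-- A complex point `f₀ ∈ Ω^And_{X₀}(ℂ)` of the torsor of motivated periods **is filtered** if, on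
every power `X₀^m` and in every degree `i`, it carries the base-changed Hodge filtration
`Fᵖ Hⁱ_dR(X₀^m) ⊗_{k,σ} ℂ` of de Rham cohomology onto the Hodge filtration `Fᵖ` of the Hodge
structure `P.B.hodge hXσ i` on `Hⁱ_B((X₀^m)_σ) ⊗_ℚ ℂ`, for every `p : ℤ` and every proof `hXσ` that
`(X₀^m)_σ` is smooth projective of dimension `m * n` — the compatibility with the Hodge
filtrations that the comparison isomorphism enjoys (Deligne 1982, Thm. 1.4; the axiom
`PeriodRealization.iso_fil`, whose shape this repeats verbatim with `f₀.iso m i` in place of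
`P.iso σ (X₀^m) i`), asked of an arbitrary complex point; cf. "`f_dR` is compatible with the Hodge
filtrations" (Deligne–Milne 1982, Prop. 6.1 (e)) and filtered fibre functors (loc. cit., end of §5;
Saavedra 1972, IV.2): informally the filtered points are the translate `c · Q(ℂ)` of the parabolic
stabiliser `Q` of the Hodge filtration. [folklore] -/
def IsFiltered (f₀ : P.MotivatedPeriodTorsor σ n X₀ (AlongHom ℂ σ)) : Prop :=
  ∀ (m i : ℕ) (hXσ : IsSmoothProjective (m * n) ((baseChangeHom σ).obj (X₀.pow m))) (p : ℤ),
    ((((P.dR.fil (X := X₀.pow m) i p).baseChange (AlongHom ℂ σ)).map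
      (f₀.iso m i).toLinearMap).restrictScalars ℚ).map
        (alongHomTensorEquiv σ ((P.B.comap σ).obj (X₀.pow m) i)).toLinearMap =
      ((P.B.hodge hXσ i).F p).restrictScalars ℚ

/-- Membership form of the filtered condition: for a filtered complex point `f₀`, an element of
`ℂ ⊗_ℚ Hⁱ_B((X₀^m)_σ)` lies in the Hodge filtration `Fᵖ` iff it is the image under `f₀` (read in
`ℂ ⊗_ℚ H_B` through `alongHomTensorEquiv`) of an element of `Fᵖ Hⁱ_dR(X₀^m) ⊗_{k,σ} ℂ`. [folklore] -/
lemma IsFiltered.mem_hodgeF_iff {f₀ : P.MotivatedPeriodTorsor σ n X₀ (AlongHom ℂ σ)}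
    (hf : f₀.IsFiltered) (m i : ℕ)
    (hXσ : IsSmoothProjective (m * n) ((baseChangeHom σ).obj (X₀.pow m))) (p : ℤ)
    (y : ℂ ⊗[ℚ] (P.B.comap σ).obj (X₀.pow m) i) :
    y ∈ (P.B.hodge hXσ i).F p ↔
      ∃ x ∈ (P.dR.fil (X := X₀.pow m) i p).baseChange (AlongHom ℂ σ),
        alongHomTensorEquiv σ ((P.B.comap σ).obj (X₀.pow m) i) (f₀.iso m i x) = y := by
  calc y ∈ (P.B.hodge hXσ i).F p
      ↔ y ∈ ((((P.dR.fil (X := X₀.pow m) i p).baseChange (AlongHom ℂ σ)).map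
            (f₀.iso m i).toLinearMap).restrictScalars ℚ).map
              (alongHomTensorEquiv σ ((P.B.comap σ).obj (X₀.pow m) i)).toLinearMap :=
        (SetLike.ext_iff.mp (hf m i hXσ p) y).symm
    _ ↔ _ := by
        constructor
        · rintro ⟨z, ⟨x, hx, rfl⟩, rfl⟩
          exact ⟨x, hx, rfl⟩
        · rintro ⟨x, hx, rfl⟩
          exact Submodule.mem_map_of_mem (Submodule.mem_map_of_mem hx)

end MotivatedPeriodTorsor

/-- **The comparison isomorphism is a filtered point** of the torsor of motivated periods: on every
power `X₀^m` (smooth projective of dimension `m * n`, `IsSmoothProjective.pow`) the comparison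
carries `Fᵖ H_dR ⊗_{k,σ} ℂ` onto the Hodge filtration of Betti cohomology (Deligne 1982, Thm. 1.4),
which is the axiom `P.iso_fil`. [cite: Deligne1982HodgeCycles, Thm. 1.4] -/
theorem isFiltered_comparisonPoint (P : PeriodRealization k) (σ : k →+* ℂ) {n : ℕ}
    {X₀ : SchemeOver k} (hX : IsSmoothProjective n X₀) : (P.comparisonPoint σ hX).IsFiltered :=
  fun m i hXσ p => P.iso_fil σ (hX.pow m) hXσ i p

/-! ### Density of the filtered points -/

/-- **The filtered complex points of the torsor of motivated periods of `X₀` are `k`-Zariski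
dense** (`MotivatedPeriodTorsor.IsFiltered`: the points carrying `Fᵖ Hⁱ_dR(X₀^m) ⊗_{k,σ} ℂ` onto
the Hodge filtration of `Hⁱ_B((X₀^m)_σ) ⊗ ℂ` for all `m, i, p`), rendered on coordinates through the
universal point, as for the density `Z_X = Ω` of the comparison in Bost–Charles 2014, Def. 2.9 and
Cor. 2.11 (`Z_X` the `ℚ̄`-Zariski closure of `c` inside the torsor; here the closure of the filtered
locus): every polynomial `Φ` over `k` in the coordinates `Coord` vanishing at every filtered complex
point `f₀` — `Φ(f₀) = 0` in `ℂ`, coefficients embedded by `σ` — vanishes at every `R`-point of the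
torsor, for every commutative `k`-algebra `R` (informally: `Z_{X₀} · Q = Ω^And_{X₀}`, `Q` the
stabiliser of the Hodge filtration). A `Prop`-valued PREDICATE of the data `(P, σ, n, X₀)`, binders
explicit, asserted nowhere in this file; it follows from the density of the comparison point itself,
since `c` is filtered (`isFiltered_comparisonPoint`; the implication is the theorem stated right
after this definition). Meaningful for `X₀` smooth projective of dimension `n` and the classical
realization; STATUS and provenance: module docstring (Design notes). [cite: BostCharles2014, Def. 2.9 with Cor. 2.11] -/
def FilteredPointsDense (P : PeriodRealization k) (σ : k →+* ℂ) (n : ℕ) (X₀ : SchemeOver k) :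
    Prop :=
  ∀ Φ : MvPolynomial (P.Coord σ X₀) k,
    (∀ f₀ : P.MotivatedPeriodTorsor σ n X₀ (AlongHom ℂ σ), f₀.IsFiltered →
      MvPolynomial.aeval f₀.coord Φ = 0) →
    ∀ (R : Type) [CommRing R] [Algebra k R] [Algebra ℚ R] (f : P.MotivatedPeriodTorsor σ n X₀ R),
      MvPolynomial.aeval f.coord Φ = 0

variable {P : PeriodRealization k} {σ : k →+* ℂ} {n : ℕ} {X₀ : SchemeOver k}

/-- **`GPC_And(X₀)` implies filtered density**: if the comparison is `k`-Zariski dense in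
`Ω^And_{X₀}` (`TorsorPeriodConjecture`, Bost–Charles 2014, Conj. 2.12 with Cor. 2.11) then so are the
filtered complex points, because the comparison is one of them (`isFiltered_comparisonPoint`,
`coord_comparisonPoint`). [folklore] -/
theorem TorsorPeriodConjecture.filteredPointsDense (h : P.TorsorPeriodConjecture σ n X₀)
    (hX : IsSmoothProjective n X₀) : P.FilteredPointsDense σ n X₀ :=
  fun Φ hΦ R _ _ _ f =>
    h Φ (by simpa only [coord_comparisonPoint] using hΦ _ (P.isFiltered_comparisonPoint σ hX)) R f

/-- The linear case of `FilteredPointsDense` (the polynomial `Φ = X_x` of a single coordinate): a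
coordinate vanishing at every filtered complex point vanishes at every point of the torsor. With
`x = .isoInv m i β ψ`, `ψ` ranging over the annihilator of `Fᵖ H_dR`, this is the form consumed by
`TorsorGPCImpliesPolicing` (`f₀⁻¹(1 ⊗ β) ∈ ℂ ⊗ Fᵖ` for all filtered `f₀` `⟹ f⁻¹(1 ⊗ β) ∈ R ⊗ Fᵖ`). [folklore] -/
lemma FilteredPointsDense.coord_eq_zero (h : P.FilteredPointsDense σ n X₀) {x : P.Coord σ X₀}
    (hx : ∀ f₀ : P.MotivatedPeriodTorsor σ n X₀ (AlongHom ℂ σ), f₀.IsFiltered → f₀.coord x = 0)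
    {R : Type} [CommRing R] [Algebra k R] [Algebra ℚ R] (f : P.MotivatedPeriodTorsor σ n X₀ R) :
    f.coord x = 0 := by
  have h' := h (MvPolynomial.X x) (fun f₀ hf₀ => by rw [MvPolynomial.aeval_X, hx f₀ hf₀]) R f
  rwa [MvPolynomial.aeval_X] at h'

end PeriodRealization

end Literature.AlgebraicGeometry.Motives

end
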